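import Summits.CriticalPhenomena.PercolationContinuityZ3.Theorems.PercGamblersRuinBGNOffTheFloorLinearLRO
import Summits.CriticalPhenomena.PercolationContinuityZ3.Theorems.PercGamblersRuinBGNOffTheFloorSplit
import Summits.CriticalPhenomena.PercolationContinuityZ3.Theorems.PercFiniteBoxLRORenormaliseFromLinearLROAnatomy
import HarnessLib

/-!
# `BGNOffTheFloor` (stmt-CriticalPhenomena-7773) dominates `RenormaliseFromLinearLRO` (stmt-CriticalPhenomena-0857)

Crux `Summit.CriticalPhenomena.PercolationContinuityZ3.Theses.PercGamblersRuin.BGNOffTheFloor`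
(route `PercGamblersRuin`, item stmt-CriticalPhenomena-7773), line `registered` (lead c5).
Support lemmas (`--supports`), proved. They record a second EDGE between routes (the first,
`OffFloor.bgnOffTheFloor_iff_continuity_of_linearScaleLROOfTheta`, p153598, is "modulo `X_D` = stmt-0855
the crux is the summit"): **already the existential shadow `UnitRatioBGN` of the crux implies the crux
`RenormaliseFromLinearLRO` (`R`, stmt-CriticalPhenomena-0857) of route `PercFiniteBoxLRO` outright.**

`R` says: for every `p`, linear-scale box long-range order at `p`
(`LRO_lin(p) := ∃ ρ > 0, K, ∀ n ≥ 1, ∀ x y ∈ Λ(n), P_p(x ↔ y in Λ(K n)) ≥ ρ`) forces `θ(p') > 0` at some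
`p' < p`; by the anatomy file of crux 0857 (`RenormaliseFromLinearLRO.stub_cruxIffNotLinearLROAtPc`)
`R ⟺ ¬LRO_lin(p_c)`. And `UnitRatioBGN ⟹ ¬LRO_lin(p_c)`: FKG chaining of box connections above the
receding floor (`OffFloor.climb_ge_of_boxLRO`, p153598) turns `LRO_lin(p_c)` into
`P_{p_c}(E(m, b₀ m)) ≥ ρ^(max K 1 · b₀)` for all `m ≥ max K 1`, while `UnitRatioBGN` says the left side is
`< ρ^(max K 1 · b₀)` for infinitely many `m`.

So the crux family is sandwiched between items of two routes:
`θ(p_c) = 0 ⟹ BGNOffTheFloor ⟹ UnitRatioBGN ⟹ ¬LRO_lin(p_c) ⟺ RenormaliseFromLinearLRO`, and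
`UnitRatioBGN ∧ LinearScaleLROOfTheta ⟹ θ(p_c) = 0` (p153598): in route `PercFiniteBoxLRO`
(`X_D ∧ R ⟹` summit) the item `R` may be replaced by `UnitRatioBGN`, and any proof of stmt-7773 is a
proof of stmt-0857.

Notation: `E(A, L) = {ω | ∃ y, y₀ = L ∧ ω ∈ {0 ⟷ y in {z | -A < z₀}}}`;
`UnitRatioBGN :≡ ∃ b₀, ∀ ε > 0, ∃ᶠ m, P_{p_c}(E(m, b₀ m)) < ε` (registered stub `stub_unitRatioBGN` of
the line, verbatim as a hypothesis below).

References: G. Grimmett, *Percolation*, 2nd ed. (1999), §1.4 and Thm. 2.1; R. Cerf, Ann. Probab. 43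
(2015), arXiv:1306.3105, p. 5 ("the missing ingredient").
-/

noncomputable section

namespace Summit.CriticalPhenomena.PercolationContinuityZ3.Theorems

open MeasureTheory Filter Literature.Probability.Percolation Literature.Probability.LatticeModels

namespace OffFloor

/-- **`UnitRatioBGN` excludes linear-scale box LRO at `p_c`**: box LRO at `p_c` gives
`P_{p_c}(E(m, b₀ m)) ≥ ρ^(max K 1 · b₀)` for `m ≥ max K 1` (`climb_ge_of_boxLRO` with `a = 1`), against
`liminf_m P_{p_c}(E(m, b₀ m)) = 0`. [folklore] -/
theorem not_linearLRO_criticalProbI_of_unitRatioBGN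
    (hU : ∃ b₀ : ℕ, ∀ ε : ℝ, 0 < ε → ∃ᶠ m : ℕ in atTop,
      (bondPercolation (zdGraph 3) (criticalProbI 3)).real
        {ω | ∃ y : Site 3, y 0 = ((b₀ * m : ℕ) : ℤ) ∧
          ω ∈ openConnIn {z : Site 3 | -((m : ℕ) : ℤ) < z 0} 0 y} < ε) :
    ¬ (∃ ρ : ℝ, 0 < ρ ∧ ∃ K : ℕ, ∀ n : ℕ, 1 ≤ n → ∀ x ∈ box 3 n, ∀ y ∈ box 3 n,
        ρ ≤ (bondPercolation (zdGraph 3) (criticalProbI 3)).real (openConnIn ↑(box 3 (K * n)) x y)) := by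
  rintro ⟨ρ, hρ, K, hK⟩
  obtain ⟨b₀, hb₀⟩ := hU
  obtain ⟨m, hlt, hm⟩ :=
    ((hb₀ (ρ ^ (max K 1 * b₀)) (pow_pos hρ _)).and_eventually (eventually_ge_atTop (max K 1))).exists
  have hlow := climb_ge_of_boxLRO (p := criticalProbI 3) hK hρ.le (le_refl 1) b₀ m hm
  simp only [one_mul] at hlow
  exact absurd hlow (not_le.2 hlt)

/-- **`BGNOffTheFloor` excludes linear-scale box LRO at `p_c`** (through its instance `(a,b) = (1,2)`,
`unitRatioBGN_of_bgnOffTheFloor`, p158687). [folklore] -/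
theorem not_linearLRO_criticalProbI_of_bgnOffTheFloor (h : Theses.PercGamblersRuin.BGNOffTheFloor) :
    ¬ (∃ ρ : ℝ, 0 < ρ ∧ ∃ K : ℕ, ∀ n : ℕ, 1 ≤ n → ∀ x ∈ box 3 n, ∀ y ∈ box 3 n,
        ρ ≤ (bondPercolation (zdGraph 3) (criticalProbI 3)).real (openConnIn ↑(box 3 (K * n)) x y)) :=
  not_linearLRO_criticalProbI_of_unitRatioBGN (unitRatioBGN_of_bgnOffTheFloor h)

end OffFloor

/-- **`UnitRatioBGN ⟹ RenormaliseFromLinearLRO`** (stmt-CriticalPhenomena-0857 of route `PercFiniteBoxLRO`,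
verbatim as the conclusion): BGN at ONE positive relative depth already implies static renormalisation
from linear-scale LRO, because `R ⟺ ¬LRO_lin(p_c)` (anatomy of crux 0857,
`RenormaliseFromLinearLRO.renormaliseFromLinearLRO_of_not_linearLRO_criticalProbI`) and `UnitRatioBGN`
excludes `LRO_lin(p_c)`. [folklore] -/
theorem renormaliseFromLinearLRO_of_unitRatioBGN
    (hU : ∃ b₀ : ℕ, ∀ ε : ℝ, 0 < ε → ∃ᶠ m : ℕ in atTop,
      (bondPercolation (zdGraph 3) (criticalProbI 3)).real
        {ω | ∃ y : Site 3, y 0 = ((b₀ * m : ℕ) : ℤ) ∧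
          ω ∈ openConnIn {z : Site 3 | -((m : ℕ) : ℤ) < z 0} 0 y} < ε) :
    Theses.PercFiniteBoxLRO.RenormaliseFromLinearLRO :=
  RenormaliseFromLinearLRO.renormaliseFromLinearLRO_of_not_linearLRO_criticalProbI
    (OffFloor.not_linearLRO_criticalProbI_of_unitRatioBGN hU)

/-- **`BGNOffTheFloor ⟹ RenormaliseFromLinearLRO`**: the crux stmt-CriticalPhenomena-7773 of route
`PercGamblersRuin` implies the crux stmt-CriticalPhenomena-0857 of route `PercFiniteBoxLRO`. [folklore] -/
theorem renormaliseFromLinearLRO_of_bgnOffTheFloor (h : Theses.PercGamblersRuin.BGNOffTheFloor) :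
    Theses.PercFiniteBoxLRO.RenormaliseFromLinearLRO :=
  RenormaliseFromLinearLRO.renormaliseFromLinearLRO_of_not_linearLRO_criticalProbI
    (OffFloor.not_linearLRO_criticalProbI_of_bgnOffTheFloor h)


/-- **Registered structural stub `stub_dominatesRenormalise` of line `registered` (birth) of
`BGNOffTheFloor`, registered signature verbatim**: the load-bearing open stub `stub_unitRatioBGN` (as a
hypothesis) implies the crux `RenormaliseFromLinearLRO` (stmt-CriticalPhenomena-0857) of route
`PercFiniteBoxLRO`. [folklore] -/
theorem stub_dominatesRenormalise :
    (∃ b₀ : ℕ, ∀ ε : ℝ, 0 < ε → ∃ᶠ m : ℕ in atTop,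
      (bondPercolation (zdGraph 3) (criticalProbI 3)).real
        {ω | ∃ y : Site 3, y 0 = ((b₀ * m : ℕ) : ℤ) ∧
          ω ∈ openConnIn {z : Site 3 | -((m : ℕ) : ℤ) < z 0} 0 y} < ε) →
    Summit.CriticalPhenomena.PercolationContinuityZ3.Theses.PercFiniteBoxLRO.RenormaliseFromLinearLRO :=
  renormaliseFromLinearLRO_of_unitRatioBGN

end Summit.CriticalPhenomena.PercolationContinuityZ3.Theorems

end
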